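import Summits.Ventures.PercRepro.RankLevelSetLevelSixT22AssemblyThree
import Summits.Ventures.PercRepro.RankLevelSetLevelSixT22Free12Le26Match

/-!
# PercRepro — THE 22 ROW IS A THEOREM: C-025 AT LEVEL `6` FOR EVERY `p ≥ 22` (p8 g14, S3)

The last branch — coloop-free `e`-free cores of rank `22` on `34` points with `25` or `26` triangles — closes by the
MATCHING LEVER (`c025_core_six_t22_free12_le26_match`): with more than `cq3 11 = 24` triangles every point lies on a
triangle (RankLevelSetTriangleCover), hence ten pairwise disjoint triangles exist (RankLevelSetTriangleMatching,
`|E| ≤ |𝒟| + 2d`), and the spanning tail drops from `6.1 %` to `2.3 %` of `2^n` (`ncard_spanning_le_of_disjoint_triangles`).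
Hence the coloop-free cell `(22, 12)` is unconditional (`c025_core_six_t22_free12`), the core cell `(22, 12)` is a theorem
(`c025_core_six_twentytwo_12`), and with the core cell `(22, 11)` of RankLevelSetLevelSixT22AssemblyThree
**`c025_six_large_twenty_two : 22 ≤ p → RLS M p 6`** on every finite matroid. Axioms: standard.
-/

open scoped Matroid

namespace PercRepro

namespace ThmN

variable {α : Type}

/-- **THE COLOOP-FREE CELL `(22, 12)`, UNCONDITIONAL**: `s₃ ≤ 21` on the crude tail, `s₃ ≤ 23` with two triangles,
`s₃ = 24` with three, `25 ≤ s₃ ≤ 26` (the cap) with ten disjoint ones. -/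
theorem c025_core_six_t22_free12 (N : Matroid α) [N.Finite] (hcf : ∀ e ∈ N.E, ¬ N.IsColoop e)
    (hRN : N.eRank = (22 : ℕ∞)) (hnN : N.E.ncard = 22 + 12)
    (hfreeN : ∀ e ∈ N.E, ∃ A ⊆ N.E \ {e}, e ∉ N.closure A ∧ e ∉ N.closure ((N.E \ {e}) \ A)) : RLS N 22 6 := by
  have hd : N.E.encard = N.eRank + (12 : ℕ) := by
    rw [hRN, ← N.ground_finite.cast_ncard_eq, hnN]
    push_cast
    ring
  have hcap : {C : Set α | N.IsCircuit C ∧ C.ncard = 3}.ncard ≤ 26 :=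
    s3_cf_of N hfreeN hcf (d := 11) (by simpa using hd) 34 26 (by norm_num) (by omega) (by decide) (by decide) (by decide)
  refine c025_core_six_t22_free12_of_many25 N hcf hRN hnN hfreeN ?_
  intro h25
  exact c025_core_six_t22_free12_le26_match N hcf hcap h25 hRN hnN hfreeN

/-- **THE CORE CELL `(22, 12)` IS A THEOREM** (the coloop device on the unconditional coloop-free cell and the scaled cell). -/
theorem c025_core_six_twentytwo_12 (M : Matroid α) [M.Finite]
    (hR : M.eRank = (22 : ℕ∞)) (hn : M.E.ncard = 22 + 12)
    (hfree : ∀ e ∈ M.E, ∃ A ⊆ M.E \ {e}, e ∉ M.closure A ∧ e ∉ M.closure ((M.E \ {e}) \ A)) : RLS M 22 6 :=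
  c025_core_six_twentytwo_12_of_free M hR hn hfree
    (fun N _ hcf hRN hnN hfreeN => c025_core_six_t22_free12 N hcf hRN hnN hfreeN)
    (fun N _ hcf hRN hnN hfreeN => c025_core_six_t22_scaled1_cf12 N hcf hRN hnN hfreeN)

/-- **C-025 AT LEVEL `6` FOR EVERY `p ≥ 22`, EVERY FINITE MATROID** — the 22 row and everything above it. -/
theorem c025_six_large_twenty_two (M : Matroid α) [M.Finite] (p : ℕ) (hp : 22 ≤ p) : RLS M p 6 :=
  c025_six_large_twenty_two_of
    (fun N _ hRN hnN hfreeN => c025_core_six_twentytwo_11 N hRN hnN hfreeN)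
    (fun N _ hRN hnN hfreeN => c025_core_six_twentytwo_12 N hRN hnN hfreeN) M p hp

end ThmN

end PercRepro
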